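import Summits.Ventures.LatticeQCDFlow.Scoring.U1TorusSectorIntegrand
import HarnessLib

/-!
# Topological sectors of two-dimensional `U(1)` on the torus, II: the exact topological-charge law

HONEST FRAMING: exact (Metropolis-corrected) sampling algorithms for lattice gauge theory;
figures of merit are autocorrelation/cost numbers at stated couplings and volumes; no
continuum-physics claim.

Venture `LatticeQCDFlow` (cell pub-lqcd), sub-topic `Scoring`; FANOUT row 5 (`s0-sun-a`), GEN-8.
NEW WORK of the cell (placement rule); part 2 of 2 (part 1: `Scoring/U1TorusSectorIntegrand.lean`).
The cell's exactness battery scores every 2-d `U(1)` chain against the exact sector weights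
`π_k = P(Q = k)` of `ref-exact`'s `ORACLE-u1-2d.json` ("`pi_k = g_V(2πk) / Σ_j g_V(2πj)`, `g_V` =
`V`-fold convolution of `p(θ) ∝ exp(β cos θ)` on one period; `Q = (1/2π) Σ_P θ_P`, `θ_P ∈ (−π, π]`").
Here that formula is PROVED for the Wilson measure `μ_{Λ,β} = wilsonMeasure u1Rep β` of compact
`U(1)` on `Λ = (ℤ/L)²` and theory-2's `topCharge` (`Scaling/TopologicalCollar.lean`).

Results (`L ≥ 2`, every real `β`, every `k ∈ ℤ`; `V = L²`; `g_V(2πk) = u1SectorWeight β V k`, the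
`V`-fold real-line convolution power of `p_β = e^{−β(1−cos φ)} 1_{[−π,π]}` at `2πk`):

* **`wilsonWeight_topCharge_eq`** — `∫_{Q = k} e^{−βS} dHaar^{⊗E} = (2π)^{−(V−1)} · g_V(2πk)`;
* **`partitionFunction_eq_tsum_sectorWeight`** — `Z_{Λ,β} = (2π)^{−(V−1)} Σ_{k ∈ ℤ} g_V(2πk)` (the
  oracle's "Poisson self-check" identity `Σ_k g_V(2πk) = (2π)^{V−1} Z` in the tree's normalisation),
  with `tsum_u1SectorWeight_ne` (the total is neither `0` nor `∞`);
* **`wilsonMeasure_topCharge_eq`** — THE LAW `μ_{Λ,β}{Q = k} = g_V(2πk) / Σ_{j ∈ ℤ} g_V(2πj)`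
  (`wilsonMeasure_topCharge_toReal` in real numbers), and `wilsonMeasure_topCharge_symm`
  (`P(Q = −k) = P(Q = k)`, whence `⟨Q⟩ = 0`).

Proof (§4): in angles `U_x = e^{iθ_x}`, `θ ∈ (−π, π]^Λ` (`CircleHaar.measurePreserving_exp_pi`), the
eliminated plaquette is `e^{−iS}`, `S = Σ_{x ≠ x₀} θ_x`; its angle is the representative of `−S` in
`(−π, π]`, so `Q = k` iff `2πk − S ∈ (−π, π]` and its weight is `p_β(2πk − S)`
(`sectorIntegrand'_exp_of_mem`); integrating the `V − 1` free angles is the convolution power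
(`lmarginal_eq_iterate_lconv`) and the angle at the puncture contributes `2π`
(`lintegral_cube_sectorIntegrand'_exp`).  §5 assembles, sums over `k` (the sectors partition the
configuration space, `exists_int_eq_topCharge`) and normalises.  No character expansion, no
Fourier analysis.  References for the classical formula (log/geometric charge): C. Bonati,
P. Rossi, Phys. Rev. D 99 (2019) 054503; M. Hirasawa, A. Matsumoto, J. Nishimura, A. Yosprakob,
JHEP 09 (2020) 023 [arXiv:2004.13982] §7 (`Z(θ) = Σ_n 𝓘(n,θ,β)^V`, the Fourier-dual form).
NOT here: the Fourier / Poisson-summation representation `g_V(x) = (2π)⁻¹ ∫ e^{−iλx} f(λ)^V dλ` the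
oracle uses to EVALUATE `g_V`, numerical values, `χ_t`, other boundary conditions or gauge groups.
-/

noncomputable section

open MeasureTheory Set Real
open scoped ENNReal
open Literature.MathematicalPhysics.QuantumFieldTheory
open Literature.MathematicalPhysics.QuantumLattice (u1Rep u1Rep_apply continuous_u1Rep magneticFlux
  abelianFieldTensor circleExp_finset_sum)
open Summit.Ventures.LatticeQCDFlow.Theory2.Lattice (topCharge exists_int_eq_topCharge
  measurable_topCharge)
open Summit.Ventures.LatticeQCDFlow.Theory2.Lattice.TwoDim

namespace Summit.Ventures.LatticeQCDFlow.Scoring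

variable (β : ℝ) {L : ℕ} [NeZero L]

/-! ### 4. In angles: the integrand on the cube `(−π, π]^Λ` -/

/-- `arg e^{iφ} = φ` on the period `(−π, π]`. -/
theorem arg_coe_exp_of_mem {φ : ℝ} (h : φ ∈ Ioc (-π) π) :
    Complex.arg (Circle.exp φ : ℂ) = φ :=
  Circle.arg_exp h.1 h.2

/-- `arg e^{−iS} + S = 2πk` iff `2πk − S ∈ (−π, π]` (`arg e^{−iS}` is the representative of `−S`
modulo `2π` in `(−π, π]`). -/
theorem arg_exp_neg_add_eq_iff (S : ℝ) (k : ℤ) :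
    Complex.arg (Circle.exp (-S) : ℂ) + S = 2 * π * k ↔ 2 * π * k - S ∈ Ioc (-π) π := by
  rw [Circle.coe_exp, Complex.arg_exp_mul_I, ← eq_sub_iff_add_eq, toIocMod_eq_iff,
    show -π + 2 * π = π by ring]
  constructor
  · exact fun h => h.1
  · exact fun h => ⟨h, -k, by rw [zsmul_eq_mul, Int.cast_neg]; ring⟩

/-- **The eliminated integrand in angles, inside the period cube.**  For `θ ∈ (−π, π]^Λ`:
`F'_k(e^{iθ}) = p̃_β(2πk − Σ_{x ≠ x₀} θ_x) · ∏_{x ≠ x₀} p̃_β(θ_x)` (`p̃_β = u1AngleWeightIoc β`): the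
eliminated plaquette is `e^{−iS}`, `S = Σ_{x ≠ x₀} θ_x`, its angle is the representative of `−S` in
`(−π, π]`, so `Q = k` iff that representative is `2πk − S`, and its weight is `e^{−β(1 − cos(2πk − S))}`. -/
theorem sectorIntegrand'_exp_of_mem (k : ℤ) (x₀ : Site 2 L) {θ : Site 2 L → ℝ}
    (hθ : ∀ x, θ x ∈ Ioc (-π) π) :
    sectorIntegrand' β k x₀ (fun x => Circle.exp (θ x)) =
      u1AngleWeightIoc β (2 * π * k - ∑ x ∈ Finset.univ.erase x₀, θ x) *
        ∏ x ∈ Finset.univ.erase x₀, u1AngleWeightIoc β (θ x) := by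
  set R := Finset.univ.erase x₀ with hR
  set S := ∑ x ∈ R, θ x with hS
  have hprod : (∏ x ∈ R, Circle.exp (θ x))⁻¹ = Circle.exp (-S) := by
    rw [← circleExp_finset_sum, ← Circle.exp_neg]
  have hsum : ∑ x, Complex.arg
      ((Function.update (fun x => Circle.exp (θ x)) x₀ (Circle.exp (-S)) x : Circle) : ℂ) =
      Complex.arg (Circle.exp (-S) : ℂ) + S := by
    rw [← Finset.add_sum_erase _ _ (Finset.mem_univ x₀), Function.update_self]
    congr 1
    refine Finset.sum_congr rfl fun x hx => ?_
    rw [Function.update_of_ne (Finset.ne_of_mem_erase hx), arg_coe_exp_of_mem (hθ x)]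
  have hw : ∏ x, u1CircleWeight β
      (Function.update (fun x => Circle.exp (θ x)) x₀ (Circle.exp (-S)) x) =
      u1CircleWeight β (Circle.exp (-S)) * ∏ x ∈ R, u1AngleWeightIoc β (θ x) := by
    rw [← Finset.mul_prod_erase _ _ (Finset.mem_univ x₀), Function.update_self]
    congr 1
    refine Finset.prod_congr rfl fun x hx => ?_
    rw [Function.update_of_ne (Finset.ne_of_mem_erase hx), u1CircleWeight_exp, u1AngleWeightIoc,
      indicator_of_mem (hθ x)]
  unfold sectorIntegrand' sectorIntegrand
  beta_reduce
  rw [hprod]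
  by_cases hk : 2 * π * k - S ∈ Ioc (-π) π
  · have hmem : Function.update (fun x => Circle.exp (θ x)) x₀ (Circle.exp (-S)) ∈
        {g : Site 2 L → Circle | ∑ x, Complex.arg (g x : ℂ) = 2 * π * k} := by
      show ∑ x, Complex.arg
        ((Function.update (fun x => Circle.exp (θ x)) x₀ (Circle.exp (-S)) x : Circle) : ℂ) = _
      rw [hsum, arg_exp_neg_add_eq_iff]
      exact hk
    rw [indicator_of_mem hmem, hw, u1AngleWeightIoc, indicator_of_mem hk, u1CircleWeight_exp,
      Real.cos_neg, show 2 * π * (k : ℝ) - S = (k : ℝ) * (2 * π) - S by ring,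
      Real.cos_int_mul_two_pi_sub]
  · have hnmem : Function.update (fun x => Circle.exp (θ x)) x₀ (Circle.exp (-S)) ∉
        {g : Site 2 L → Circle | ∑ x, Complex.arg (g x : ℂ) = 2 * π * k} := by
      intro h
      have h' : ∑ x, Complex.arg
        ((Function.update (fun x => Circle.exp (θ x)) x₀ (Circle.exp (-S)) x : Circle) : ℂ) = _ := h
      rw [hsum, arg_exp_neg_add_eq_iff] at h'
      exact hk h'
    rw [indicator_of_notMem hnmem, u1AngleWeightIoc, indicator_of_notMem hk, zero_mul]

/-- **The eliminated integrand in angles, on all of `ℝ^Λ`** (with the cube's indicator): it is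
`p̃_β(2πk − Σ_{x ≠ x₀} θ_x) · ∏_{x ≠ x₀} p̃_β(θ_x)` times the free factor `1_{(−π,π]}(θ_{x₀})`. -/
theorem indicator_cube_sectorIntegrand'_exp (k : ℤ) (x₀ : Site 2 L) (θ : Site 2 L → ℝ) :
    (Set.pi univ fun _ : Site 2 L => Ioc (-π) π).indicator
        (fun θ : Site 2 L → ℝ => sectorIntegrand' β k x₀ (fun x => Circle.exp (θ x))) θ =
      (u1AngleWeightIoc β (2 * π * k - ∑ x ∈ Finset.univ.erase x₀, θ x) *
        ∏ x ∈ Finset.univ.erase x₀, u1AngleWeightIoc β (θ x)) *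
      (Ioc (-π) π).indicator 1 (θ x₀) := by
  by_cases hθ : θ ∈ Set.pi univ fun _ : Site 2 L => Ioc (-π) π
  · have hθ' : ∀ x, θ x ∈ Ioc (-π) π := fun x => hθ x (mem_univ x)
    rw [indicator_of_mem hθ, sectorIntegrand'_exp_of_mem β k x₀ hθ', indicator_of_mem (hθ' x₀),
      Pi.one_apply, mul_one]
  · rw [indicator_of_notMem hθ]
    obtain ⟨x, hx⟩ : ∃ x, θ x ∉ Ioc (-π) π := by
      simpa only [Set.mem_univ_pi, not_forall] using hθ
    by_cases hx0 : x = x₀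
    · subst hx0
      rw [indicator_of_notMem hx, mul_zero]
    · have h0 : u1AngleWeightIoc β (θ x) = 0 := by
        rw [u1AngleWeightIoc, indicator_of_notMem hx]
      rw [Finset.prod_eq_zero (Finset.mem_erase.mpr ⟨hx0, Finset.mem_univ x⟩) h0, mul_zero,
        zero_mul]

/-- `#(Λ ∖ x₀) = L² − 1`. -/
theorem card_univ_erase_site (x₀ : Site 2 L) : (Finset.univ.erase x₀).card = L ^ 2 - 1 := by
  rw [Finset.card_erase_of_mem (Finset.mem_univ _), Finset.card_univ, Fintype.card_fun, ZMod.card,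
    Fintype.card_fin]

/-- **Integrating the free angles**: `∫_{(−π,π]^Λ} F'_k(e^{iθ}) dθ = 2π · p̃_β^{*V}(2πk)`,
`V = L²` — the `V − 1` angles off the puncture are integrated by
`lmarginal_eq_iterate_lconv`, the angle at the puncture is free. -/
theorem lintegral_cube_sectorIntegrand'_exp (k : ℤ) (x₀ : Site 2 L) :
    ∫⁻ θ in Set.pi univ fun _ : Site 2 L => Ioc (-π) π,
        sectorIntegrand' β k x₀ (fun x => Circle.exp (θ x)) =
      convPow (u1AngleWeightIoc β) (L ^ 2 - 1) (2 * π * k) * ENNReal.ofReal (2 * π) := by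
  classical
  have hcube : MeasurableSet (Set.pi univ fun _ : Site 2 L => Ioc (-π) π) :=
    MeasurableSet.univ_pi fun _ => measurableSet_Ioc
  rw [← lintegral_indicator hcube]
  simp_rw [indicator_cube_sectorIntegrand'_exp β k x₀]
  set R := Finset.univ.erase x₀ with hR
  have hw := measurable_u1AngleWeightIoc β
  have hF : Measurable fun θ : Site 2 L → ℝ =>
      u1AngleWeightIoc β (2 * π * k - ∑ x ∈ R, θ x) * ∏ x ∈ R, u1AngleWeightIoc β (θ x) :=
    (hw.comp (measurable_const.sub (Finset.measurable_sum _ fun i _ => measurable_pi_apply i))).mul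
      (Finset.measurable_prod _ fun i _ => hw.comp (measurable_pi_apply i))
  have hcm : Measurable fun θ : Site 2 L → ℝ => (Ioc (-π) π).indicator (1 : ℝ → ℝ≥0∞) (θ x₀) :=
    (measurable_one.indicator measurableSet_Ioc).comp (measurable_pi_apply x₀)
  have hc : ∀ θ (y : (i : ↥R) → ℝ),
      (fun θ : Site 2 L → ℝ => (Ioc (-π) π).indicator (1 : ℝ → ℝ≥0∞) (θ x₀))
        (Function.updateFinset θ R y) =
      (fun θ : Site 2 L → ℝ => (Ioc (-π) π).indicator (1 : ℝ → ℝ≥0∞) (θ x₀)) θ := by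
    intro θ y
    simp [Function.updateFinset, hR]
  have key := lmarginal_eq_iterate_lconv (ι := Site 2 L) hw hw R (a := fun _ => 2 * π * k)
    measurable_const (fun _ _ _ _ => rfl)
  have hx₀R : x₀ ∉ R := by rw [hR]; exact Finset.notMem_erase x₀ _
  have huniv : (Finset.univ : Finset (Site 2 L)) = insert x₀ R := by
    rw [hR, Finset.insert_erase (Finset.mem_univ x₀)]
  rw [volume_pi, lintegral_eq_lmarginal_univ (fun _ => (0 : ℝ)), huniv,
    lmarginal_insert (fun θ : Site 2 L → ℝ =>
      (u1AngleWeightIoc β (2 * π * k - ∑ x ∈ R, θ x) * ∏ x ∈ R, u1AngleWeightIoc β (θ x)) *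
        (Ioc (-π) π).indicator 1 (θ x₀)) (hF.mul hcm) hx₀R]
  simp_rw [lmarginal_mul_indep_real (c := fun θ : Site 2 L → ℝ => (Ioc (-π) π).indicator
      (1 : ℝ → ℝ≥0∞) (θ x₀)) R hF hc, key, Function.update_self]
  rw [lintegral_const_mul _ (measurable_one.indicator measurableSet_Ioc),
    lintegral_indicator_one measurableSet_Ioc, Real.volume_Ioc, show π - -π = 2 * π by ring,
    hR, card_univ_erase_site]
  rfl

/-! ### 5. The law -/

/-- `2π ≠ 0, ∞` in `ℝ≥0∞` and the normalising constant `(2π)^{−(V−1)}` is `≠ 0, ∞`. -/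
theorem inv_ofReal_two_pi_pow_ne (n : ℕ) :
    (ENNReal.ofReal (2 * π))⁻¹ ^ n ≠ 0 ∧ (ENNReal.ofReal (2 * π))⁻¹ ^ n ≠ ∞ :=
  ⟨pow_ne_zero _ (ENNReal.inv_ne_zero.2 ENNReal.ofReal_ne_top),
    ENNReal.pow_ne_top (ENNReal.inv_ne_top.2 CircleHaar.ofReal_two_pi_ne_zero)⟩

/-- **The sector mass in closed form**: for `L ≥ 2`, every real `β` and every `k ∈ ℤ`,
`∫_{Q = k} e^{−βS(U)} dHaar^{⊗E}(U) = (2π)^{−(L²−1)} · g_{L²}(2πk)`,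
`g_V = p_β^{*V}` the `V`-fold convolution power of the one-plaquette weight. -/
theorem wilsonWeight_topCharge_eq (hL : 2 ≤ L) (k : ℤ) :
    wilsonWeight (d := 2) (L := L) u1Rep β {U | topCharge U = k} =
      (ENNReal.ofReal (2 * π))⁻¹ ^ (L ^ 2 - 1) * u1SectorWeight β (L ^ 2) k := by
  have hn : 1 ≤ L ^ 2 - 1 := by
    have : 2 * 2 ≤ L * L := Nat.mul_le_mul hL hL
    rw [sq]; omega
  have hcard : Fintype.card (Site 2 L) = (L ^ 2 - 1) + 1 := by
    rw [Fintype.card_fun, ZMod.card, Fintype.card_fin]; omega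
  rw [wilsonWeight_topCharge_eq_lintegral, lintegral_sectorIntegrand_eq_pi β hL k 0,
    ← (CircleHaar.measurePreserving_exp_pi (ι := Site 2 L)).lintegral_comp
      (measurable_sectorIntegrand' β k 0),
    CircleHaar.pi_angleMeasure, lintegral_smul_measure, smul_eq_mul,
    lintegral_cube_sectorIntegrand'_exp β k 0, u1SectorWeight,
    ← convPow_congr_ae (u1AngleWeightIoc_ae_eq β) hn, hcard, pow_succ]
  rw [show ∀ a c g : ℝ≥0∞, a ^ (L ^ 2 - 1) * a * (g * c) = a ^ (L ^ 2 - 1) * g * (a * c) from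
      fun a c g => by ring,
    ENNReal.inv_mul_cancel CircleHaar.ofReal_two_pi_ne_zero ENNReal.ofReal_ne_top, mul_one]

/-- The configuration space is the disjoint union of the sectors `{Q = k}`, `k ∈ ℤ`. -/
theorem iUnion_topCharge_eq : (⋃ k : ℤ, {U : GaugeConfig 2 L Circle | topCharge U = k}) = univ := by
  ext U
  simp only [mem_iUnion, mem_setOf_eq, mem_univ, iff_true]
  obtain ⟨n, hn⟩ := exists_int_eq_topCharge U
  exact ⟨n, hn⟩

/-- **The partition function as a sum over the sectors**:
`Z_{Λ,β} = Σ_{k ∈ ℤ} ∫_{Q = k} e^{−βS} dHaar^{⊗E}`. -/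
theorem partitionFunction_eq_tsum_wilsonWeight :
    partitionFunction (d := 2) (L := L) u1Rep β =
      ∑' k : ℤ, wilsonWeight (d := 2) (L := L) u1Rep β {U | topCharge U = k} := by
  rw [partitionFunction, ← iUnion_topCharge_eq, measure_iUnion]
  · intro i j hij
    exact Set.disjoint_left.2 fun U (h1 : topCharge U = i) (h2 : topCharge U = j) =>
      hij (Int.cast_injective (h1.symm.trans h2))
  · exact fun k => measurable_topCharge (measurableSet_singleton _)

/-- **`Z_{Λ,β} = (2π)^{−(V−1)} Σ_{k ∈ ℤ} g_V(2πk)`** (`V = L²`, `L ≥ 2`): the oracle's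
"Poisson self-check" `Σ_k g_V(2πk) = (2π)^{V−1} Z` in the tree's normalisation. -/
theorem partitionFunction_eq_tsum_sectorWeight (hL : 2 ≤ L) :
    partitionFunction (d := 2) (L := L) u1Rep β =
      (ENNReal.ofReal (2 * π))⁻¹ ^ (L ^ 2 - 1) * ∑' k : ℤ, u1SectorWeight β (L ^ 2) k := by
  rw [partitionFunction_eq_tsum_wilsonWeight, ← ENNReal.tsum_mul_left]
  exact tsum_congr fun k => wilsonWeight_topCharge_eq β hL k

/-- The partition function of 2-d `U(1)` is neither `0` nor `∞` (the Wilson measure is a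
probability measure, `isProbabilityMeasure_wilsonMeasure`). -/
theorem u1_partitionFunction_ne :
    partitionFunction (d := 2) (L := L) u1Rep β ≠ 0 ∧ partitionFunction (d := 2) (L := L) u1Rep β ≠ ∞ := by
  have h := (isProbabilityMeasure_wilsonMeasure (d := 2) (L := L) u1Rep continuous_u1Rep β).measure_univ
  rw [wilsonMeasure, Measure.smul_apply, smul_eq_mul] at h
  change (partitionFunction u1Rep β)⁻¹ * partitionFunction (d := 2) (L := L) u1Rep β = 1 at h
  constructor
  · intro h0; rw [h0, mul_zero] at h; exact zero_ne_one h
  · intro ht; rw [ht, ENNReal.inv_top, zero_mul] at h; exact zero_ne_one h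

/-- The total sector weight `Σ_k g_V(2πk)` is neither `0` nor `∞`. -/
theorem tsum_u1SectorWeight_ne (hL : 2 ≤ L) :
    (∑' k : ℤ, u1SectorWeight β (L ^ 2) k) ≠ 0 ∧ (∑' k : ℤ, u1SectorWeight β (L ^ 2) k) ≠ ∞ := by
  obtain ⟨hZ0, hZt⟩ := u1_partitionFunction_ne (L := L) β
  obtain ⟨hc0, hct⟩ := inv_ofReal_two_pi_pow_ne (L ^ 2 - 1)
  rw [partitionFunction_eq_tsum_sectorWeight β hL] at hZ0 hZt
  constructor
  · intro h0; rw [h0, mul_zero] at hZ0; exact hZ0 rfl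
  · intro ht; rw [ht, ENNReal.mul_top hc0] at hZt; exact hZt rfl

/-- **THE TOPOLOGICAL-CHARGE LAW OF 2-d `U(1)`.**  For every `L ≥ 2`, every real `β` and every
`k ∈ ℤ`, the Wilson measure of compact `U(1)` on the `L × L` torus gives the topological sector
`Q = k` the probability `π_k = g_V(2πk) / Σ_{j ∈ ℤ} g_V(2πj)`, `V = L²`, `g_V = p_β^{*V}` the
`V`-fold convolution power on `ℝ` of the one-plaquette weight `p_β = e^{−β(1−cos φ)} 1_{[−π,π]}`
— the formula of the cell's exact oracle `ORACLE-u1-2d.json` (field `pi_k`). -/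
theorem wilsonMeasure_topCharge_eq (hL : 2 ≤ L) (k : ℤ) :
    wilsonMeasure (d := 2) (L := L) u1Rep β {U | topCharge U = k} =
      u1SectorWeight β (L ^ 2) k / ∑' j : ℤ, u1SectorWeight β (L ^ 2) j := by
  obtain ⟨hc0, hct⟩ := inv_ofReal_two_pi_pow_ne (L ^ 2 - 1)
  rw [wilsonMeasure, Measure.smul_apply, smul_eq_mul, partitionFunction_eq_tsum_sectorWeight β hL,
    wilsonWeight_topCharge_eq β hL k, ENNReal.mul_inv (Or.inl hc0) (Or.inl hct), div_eq_mul_inv]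
  rw [show ∀ a b G g : ℝ≥0∞, a * G * (b * g) = a * b * (g * G) from fun a b G g => by ring,
    ENNReal.inv_mul_cancel hc0 hct, one_mul]

/-- The law in real numbers: `P(Q = k) = g_V(2πk) / Σ_j g_V(2πj)` as a quotient of finite reals. -/
theorem wilsonMeasure_topCharge_toReal (hL : 2 ≤ L) (k : ℤ) :
    (wilsonMeasure (d := 2) (L := L) u1Rep β {U | topCharge U = k}).toReal =
      (u1SectorWeight β (L ^ 2) k).toReal / (∑' j : ℤ, u1SectorWeight β (L ^ 2) j).toReal := by
  rw [wilsonMeasure_topCharge_eq β hL k, ENNReal.toReal_div]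

/-- **Charge-conjugation symmetry of the law**: `P(Q = −k) = P(Q = k)`; in particular the sector
weights are symmetric and `⟨Q⟩ = 0`, as the oracle asserts. -/
theorem wilsonMeasure_topCharge_symm (hL : 2 ≤ L) (k : ℤ) :
    wilsonMeasure (d := 2) (L := L) u1Rep β {U | topCharge U = ((-k : ℤ) : ℝ)} =
      wilsonMeasure (d := 2) (L := L) u1Rep β {U | topCharge U = k} := by
  rw [wilsonMeasure_topCharge_eq β hL, wilsonMeasure_topCharge_eq β hL, u1SectorWeight_neg]

end Summit.Ventures.LatticeQCDFlow.Scoring
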